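import Summits.QuantumFields.YangMills.Theorems.BalabanUVNodesN08HaarCompatibilityGuardJacobianSharpFrame

/-!
# BalabanUVNodes ∕ N08 — THE SHARP (χ-WEIGHTED) COERCIVITY OF THE TANGENT MAP OF THE PRINTED exp-mean-log FIBRE MAP:
# `Q ⪰ (1 − Σcᵢ)·χ(B_Y)` — n08-w3's conjectured constant `1 − Σcᵢ` at the determinant ∕ eigenvalue level, equality at the flat background

WIDTH SEAT `pub-ymgap-dag-n08-w6` g3 (R399 (3a) second wave; self-located CLAIM-1 of record HOME INBOX l.29757, GO by the conjecture's author
dag-n08-w3 g4 l.29792 and dag-lead DEDUP l.29884), 2026-08-28.  Track A, DAG node N08 = [Balaban1985UV3] Thm 1 p. 257 (compact) + Thm 2 p. 272;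
key item K1⁷ `StabilityBAtRecordR13SepCoPH` (stmt-QuantumFields-20542), `--supports … --as helper`.  COUNT-NEUTRAL.  Part 2 of 2 (part 1:
`…GuardJacobianSharpFrame`, the frame calculus).

THE POINT.  For the printed exp-mean-log fibre map `K_W = exp(Σᵢ cᵢ log(hᵢ W*))·W` (unitary `W`, unitaries `hᵢ` in the guard
`‖hᵢW* − 1‖ < 1∕2`, weights `cᵢ ≥ 0`, `μ := Σcᵢ ≤ 1`, `λ := 1 − μ`) write `Zᵢ = log(hᵢW*)`, `Y = ΣcᵢZᵢ`, `B_Z = (i∕2)ad_Z` (Hermitian on `M_N(ℂ)`),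
`φ(β) = β cot β`, `χ(β) = β∕sin β`.  Up to unitary factors the tangent map of `K` at `W` on skew-Hermitian `X̃ = WXW*` is `T_Y⁻¹·Q` with
`T_Y = χ(B_Y)·(unitary)` and the SYMMETRIC operator `Q = φ(B_Y) − Σcᵢφ(B_{Zᵢ})`; pub-balaban's `core` ∕ n08-w3's `coercive` is `Q ⪰ λ·1`, whence
n08-w3's `‖D K_W(WX)‖ ≥ λ·(sin ρ∕ρ)‖X‖` (p607823) and its CONJECTURE «the sharp constant is `λ`» (numerics; equality at the flat background by
`emlD_flat`).  THIS FILE PROVES THE SHARP OPERATOR INEQUALITY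
  `Q ⪰ λ·χ(B_Y)`,  in `hs`-form:  `λ·hs(X, G♭) ≤ hs(X, H_Y) − Σcᵢ·hs(X, Hᵢ)`  (`sharp_coercive`),
where `dexp(Zᵢ)Hᵢ = exp(Zᵢ)X`, `dexp(Y)H_Y = exp(Y)X` as in `coercive` and `G♭` is the flat solution `dexp(Y)G♭ = e^{Y∕2}Xe^{Y∕2}` (`hs(X,G♭) = ⟨X, χ(B_Y)X⟩
≥ hs(X,X)`).  Since the tangent map is `(unitary)·χ(B_Y)⁻¹·Q`, this says `χ^{−1∕2}Qχ^{−1∕2} ⪰ λ`: every eigenvalue of the symmetrised tangent operator is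
`≥ λ` and `|det D K_W| ≥ λ^{dim}` on `u(N)` ∕ `su(N)` — the conjectured sharp constant AT THE DETERMINANT ∕ EIGENVALUE LEVEL, which is what a fibre-law
DENSITY constant consumes (`K = λ^{−(N²−1)}·#sheets` per bond; at the [B10] slot `λ = L^{1−d}`).  MECHANISM: (i) pub-balaban's KEY + `jensen_step` run with
the NORMALISED weights `cᵢ∕μ` at `Ŷ = Y∕μ` (same eigenframe, angles `θ∕μ`) — the perspective form `Σcᵢψ(B_{Zᵢ}) ⪰ μ·ψ(B_Y∕μ)` of operator-Jensen
(`jensen_hs_le`, total mass `≤ 1`); (ii) entrywise in the frame the claim is then part 1's `persp_scalar`, i.e. the concavity of `sin`.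

SCOPE (honest).  The Hilbert–Schmidt OPERATOR-NORM form «`σ_min(D K_W) ≥ λ`» ⟺ `Q² ⪰ λ²χ²` is strictly stronger (squaring is not operator
monotone) and is NOT asserted here — it stays n08-w3's conjecture at that level (numerics of both seats: never violated).  What the file gives in norm
form is the Cauchy–Schwarz corollary `(λ·hs(X̃,G♭))² ≤ hs(G♭,G♭)·hs(D K_W(WX), D K_W(WX))` (`emlD_sharp_lower_bound_hs`), i.e.
`‖D K_W(WX)‖ ≥ λ·⟨X̃,χX̃⟩∕‖χX̃‖`, which contains p607823's `λ·sin ρ∕ρ` (`⟨X̃,χX̃⟩ ≥ ‖X̃‖²`, `‖χX̃‖ ≤ (ρ∕sin ρ)‖X̃‖`).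

WHAT THIS FILE PROVES ([folklore] matrix analysis over part 1, `…GuardJacobian` and `T4EMLTangentInjective` BY IMPORT; nothing of Bałaban's asserted;
0 `def`).  §3 `jensen_hs_le` (`coercive` with `Σcᵢ ≤ 1`) · ★★★ `sharp_coercive`.  §4 `guard_skew_norm` (the guard data) · ★★ `emlD_sharp_coercive_hs`
(`λ·hs(X̃, G♭) ≤ hs(X̃, G')` for every `G'` with `dexp(Y)G' = D K_W(WX)·W*`) · `flat_solution_exists_and_dominates` · ★ `emlD_sharp_lower_bound_hs` ·
`emlD_sharp_coercive_hs_specialUnitary` (the typed guard `deltaSU` of `expMeanLogSU`, every `N`).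

HONEST FRAMING.  Count-neutral helper ([folklore] matrix analysis about the printed (0.4) ∕ (1.4) fibre map); E6′ NOT decided; `hmass` NOT supplied; no
quantitative `T4HaarSUNLocalDiffeo` (density form) is typed here; N08 NOT discharged; counts unmoved (typed 28∕28 · discharged 5∕27); no summit statement is
proved by this seat — one finite 𝕋⁴ programme at fixed ε, R4 closes the CONDITIONAL rung `BalabanLadder.UV` only; the Yang–Mills mass gap (Clay) is NOT
proved by any of this; nothing continuum ∕ ℝ⁴ ∕ OS ∕ mass gap.  0 `sorry`, 0 `def`, 0 `instance`, 0 `notation`, standard axioms.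
-/

noncomputable section

open NormedSpace Finset
open scoped Matrix Matrix.Norms.L2Operator ComplexConjugate Nat

namespace Summit.QuantumFields.YangMills.BalabanUVNodes.N08HaarCompatibilityGuardJacobianSharp

open Literature.MathematicalPhysics.QuantumFieldTheory.Balaban1983to89
open Literature.MathematicalPhysics.QuantumFieldTheory.Balaban1983to89.T4EMLTangentInjective
open Summit.QuantumFields.YangMills.BalabanUVNodes.N08HaarCompatibilityGuardJacobian
open Summit.QuantumFields.YangMills.BalabanUVNodes.N08HaarCompatibilityGuardJacobianSharpFrame
open Matrix (single diagonal unitaryGroup)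
open Complex (I)
open Literature.MathematicalPhysics.QuantumFieldTheory.Balaban1983to89.MatrixLog (mlog)
open T4QuatExpLog (ψ ψ_zero ψ_of_ne_zero)

variable {m : Type*} [Fintype m] [DecidableEq m]

/-! ## §3 THE SHARP (χ-WEIGHTED) COERCIVITY -/

section Sharp

variable [Nonempty m] {ι : Type*} [Fintype ι]

/-- **Jensen for the solutions `hs(X, H_Z)`, weights of total mass `≤ 1`** (`GuardJacobian.coercive` with `Σcᵢ ≤ 1`):
`Σ cᵢ·hs(X, Hᵢ) ≤ hs(X, H_Y) − (1 − Σcᵢ)·hs(X, X)` — pub-balaban's KEY + `jensen_step` + `hasSum_le`, verbatim. [folklore] -/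
theorem jensen_hs_le {Z : ι → Matrix m m ℂ} (hZ : ∀ i, (Z i)ᴴ = -Z i) (hZ1 : ∀ i, ‖Z i‖ ≤ 1)
    (c : ι → ℝ) (hc0 : ∀ i, 0 ≤ c i) (hc1 : ∑ i, c i ≤ 1) (X : Matrix m m ℂ) (H : ι → Matrix m m ℂ) (HY : Matrix m m ℂ)
    (hH : ∀ i, dexp (Z i) (H i) = exp (Z i) * X)
    (hY : dexp (∑ i, (c i : ℂ) • Z i) HY = exp (∑ i, (c i : ℂ) • Z i) * X) :
    ∑ i, c i * hs X (H i) ≤ hs X HY - (1 - ∑ i, c i) * hs X X := by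
  have hπ3 : (3 : ℝ) < Real.pi := Real.pi_gt_three
  have hYn : ‖∑ i, (c i : ℂ) • Z i‖ < Real.pi := by
    calc ‖∑ i, (c i : ℂ) • Z i‖ ≤ ∑ i, ‖(c i : ℂ) • Z i‖ := norm_sum_le _ _
      _ ≤ ∑ i, c i := Finset.sum_le_sum fun i _ => by
          rw [norm_smul, Complex.norm_real, Real.norm_of_nonneg (hc0 i)]
          nlinarith [hZ1 i, hc0 i, norm_nonneg (Z i)]
      _ < Real.pi := by linarith
  have hZn : ∀ i, ‖Z i‖ < Real.pi := fun i => by linarith [hZ1 i]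
  obtain ⟨-, v, hv, hsumY⟩ := key (conjTranspose_sum_smul c hZ) hYn X _ hY
  have kZ := fun i => key (hZ i) (hZn i) X (H i) (hH i)
  choose w hw hsumw using fun i => (kZ i).2
  have hposZ : ∀ i (n : ℕ) (M : Matrix m m ℂ), 0 ≤ hs M (Pop (Rn n) (Z i) M) := fun i => (kZ i).1
  have hle : ∀ n, 2 * hs (adh (∑ i, (c i : ℂ) • Z i) X) (v n) ≤ ∑ i, c i * (2 * hs (adh (Z i) X) (w i n)) := by
    intro n
    have hj := jensen_step (Rn_nonneg n) hZ c hc0 hc1 X (v n) (fun i => w i n) (hv n)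
      (fun i => hw i n) (fun i M => hposZ i n M)
    calc 2 * hs (adh (∑ i, (c i : ℂ) • Z i) X) (v n) ≤ 2 * ∑ i, c i * hs (adh (Z i) X) (w i n) := by
          linarith
      _ = ∑ i, c i * (2 * hs (adh (Z i) X) (w i n)) := by
          rw [Finset.mul_sum]; exact Finset.sum_congr rfl fun i _ => by ring
  have hsum2 : HasSum (fun n => ∑ i, c i * (2 * hs (adh (Z i) X) (w i n)))
      (∑ i, c i * (hs X X - hs X (H i))) :=
    hasSum_sum fun i _ => (hsumw i).mul_left (c i)
  have hineq := hasSum_le hle hsumY hsum2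
  have e2 : ∑ i, c i * (hs X X - hs X (H i)) = (∑ i, c i) * hs X X - ∑ i, c i * hs X (H i) := by
    rw [Finset.sum_mul, ← Finset.sum_sub_distrib]
    exact Finset.sum_congr rfl fun i _ => by ring
  rw [e2] at hineq
  linarith

/-- ★★★ **THE SHARP COERCIVITY OF THE exp-mean-log TANGENT SYSTEM.**  `Zᵢ` skew-Hermitian with `‖Zᵢ‖ ≤ 1`, weights
`cᵢ ≥ 0`, `μ := Σcᵢ ≤ 1`, `Y = Σ cᵢZᵢ`; for the solutions `dexp(Zᵢ)Hᵢ = exp(Zᵢ)X`, `dexp(Y)H_Y = exp(Y)X` and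
`dexp(Y)G♭ = e^{Y∕2} X e^{Y∕2}`:
  `(1 − μ)·hs(X, G♭) ≤ hs(X, H_Y) − Σ cᵢ·hs(X, Hᵢ)`.
In operator language (`B_Z = (i∕2)ad_Z`, `φ(β) = β cot β`, `χ(β) = β∕sin β`): `φ(B_Y) − Σcᵢφ(B_{Zᵢ}) ⪰ (1 − μ)·χ(B_Y)`, whereas
`GuardJacobian.coercive` is `⪰ (1 − μ)·1` (and `χ ⪰ 1`, `hs_self_le_hs_flat_solution`).  PROOF: `jensen_hs_le` with the NORMALISED
weights `cᵢ∕μ` at `Ŷ = Y∕μ` (same eigenframe as `Y`, angles `θ∕μ`) gives `Σcᵢ hs(X,Hᵢ) ≤ μ·hs(X,H_Ŷ) = Σ|X'|² μ(1 − ψ(β∕μ))`;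
the three solutions are diagonal in the frame (`hs_solution_eq`, `hs_flat_solution_eq`) and entrywise the claim is `persp_scalar`
— the concavity of `sin`. [folklore] -/
theorem sharp_coercive {Z : ι → Matrix m m ℂ} (hZ : ∀ i, (Z i)ᴴ = -Z i) (hZ1 : ∀ i, ‖Z i‖ ≤ 1)
    (c : ι → ℝ) (hc0 : ∀ i, 0 ≤ c i) (hc1 : ∑ i, c i ≤ 1) (X : Matrix m m ℂ) (H : ι → Matrix m m ℂ) (HY Gf : Matrix m m ℂ)
    (hH : ∀ i, dexp (Z i) (H i) = exp (Z i) * X)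
    (hY : dexp (∑ i, (c i : ℂ) • Z i) HY = exp (∑ i, (c i : ℂ) • Z i) * X)
    (hGf : dexp (∑ i, (c i : ℂ) • Z i) Gf
      = exp ((2⁻¹ : ℂ) • ∑ i, (c i : ℂ) • Z i) * X * exp ((2⁻¹ : ℂ) • ∑ i, (c i : ℂ) • Z i)) :
    (1 - ∑ i, c i) * hs X Gf ≤ hs X HY - ∑ i, c i * hs X (H i) := by
  set μ : ℝ := ∑ i, c i with hμdef
  set Y : Matrix m m ℂ := ∑ i, (c i : ℂ) • Z i with hYdef
  have hπ3 : (3 : ℝ) < Real.pi := Real.pi_gt_three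
  have hμ0 : 0 ≤ μ := Finset.sum_nonneg fun i _ => hc0 i
  have hYskew : Yᴴ = -Y := conjTranspose_sum_smul c hZ
  have hYn : ‖Y‖ ≤ μ := by
    calc ‖Y‖ ≤ ∑ i, ‖(c i : ℂ) • Z i‖ := norm_sum_le _ _
      _ ≤ ∑ i, c i := Finset.sum_le_sum fun i _ => by
          rw [norm_smul, Complex.norm_real, Real.norm_of_nonneg (hc0 i)]
          nlinarith [hZ1 i, hc0 i, norm_nonneg (Z i)]
  obtain ⟨U, θ, hU, hU', hYU, hθ⟩ := frame hYskew
  have hθμ : ∀ a, |θ a| ≤ μ := fun a => (hθ a).trans hYn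
  have hβμ : ∀ a b, |(θ a - θ b) / 2| ≤ μ := fun a b => by
    rw [abs_div, abs_two]; have := abs_sub (θ a) (θ b); linarith [hθμ a, hθμ b]
  have hβπ : ∀ a b, |(θ a - θ b) / 2| < Real.pi := fun a b => by linarith [hβμ a b]
  set X' : Matrix m m ℂ := star U * X * U with hX'
  -- (1), (2): the two solutions at `Y` in the frame
  have h1 : hs X HY = ∑ a, ∑ b, ‖X' a b‖ ^ 2 * (1 - ψ ((θ a - θ b) / 2)) :=
    hs_solution_eq hU hU' θ hβπ hYU X HY hY
  have h2 : hs X Gf = ∑ a, ∑ b, ‖X' a b‖ ^ 2 * (Real.sinc ((θ a - θ b) / 2))⁻¹ :=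
    hs_flat_solution_eq hU hU' θ hβπ hYU X Gf hGf
  -- (3): perspective Jensen through the normalised weights
  have h3 : ∑ i, c i * hs X (H i) ≤ ∑ a, ∑ b, ‖X' a b‖ ^ 2 * (μ * (1 - ψ ((θ a - θ b) / 2 / μ))) := by
    rcases hμ0.lt_or_eq with hμpos | hμz
    · set ch : ι → ℝ := fun i => c i / μ with hch
      have hch0 : ∀ i, 0 ≤ ch i := fun i => div_nonneg (hc0 i) hμpos.le
      have hch1 : ∑ i, ch i = 1 := by
        rw [hch]; simp only; rw [← Finset.sum_div, div_self hμpos.ne']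
      set Yh : Matrix m m ℂ := ∑ i, (ch i : ℂ) • Z i with hYhdef
      have hYhY : Yh = ((μ⁻¹ : ℝ) : ℂ) • Y := by
        rw [hYhdef, hYdef, Finset.smul_sum]
        refine Finset.sum_congr rfl fun i _ => ?_
        rw [smul_smul, hch]
        congr 1
        push_cast
        ring
      have hfun : (fun a => -I * (((θ a / μ : ℝ)) : ℂ)) = ((μ⁻¹ : ℝ) : ℂ) • (fun a => -I * (θ a : ℂ)) := by
        funext a; simp only [Pi.smul_apply, smul_eq_mul]; push_cast; ring
      have hYhU : Yh = U * diagonal (fun a => -I * (((θ a / μ : ℝ)) : ℂ)) * star U := by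
        rw [hfun, Matrix.diagonal_smul, Matrix.mul_smul, Matrix.smul_mul, ← hYU, hYhY]
      have hYhskew : Yhᴴ = -Yh := conjTranspose_sum_smul ch hZ
      have hYhn : ‖Yh‖ ≤ 1 := by
        calc ‖Yh‖ ≤ ∑ i, ‖(ch i : ℂ) • Z i‖ := norm_sum_le _ _
          _ ≤ ∑ i, ch i := Finset.sum_le_sum fun i _ => by
              rw [norm_smul, Complex.norm_real, Real.norm_of_nonneg (hch0 i)]
              nlinarith [hZ1 i, hch0 i, norm_nonneg (Z i)]
          _ = 1 := hch1
      obtain ⟨HYh, hHYh⟩ := (dexp_lower_bound_and_surjective hYhskew one_pos (by linarith) hYhn).2 (exp Yh * X)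
      have hj := jensen_hs_le hZ hZ1 ch hch0 hch1.le X H HYh hH hHYh
      rw [hch1, sub_self, zero_mul, sub_zero] at hj
      have hβπ' : ∀ a b, |(θ a / μ - θ b / μ) / 2| < Real.pi := fun a b => by
        rw [← sub_div, div_div, mul_comm, ← div_div, abs_div, abs_of_pos hμpos, div_lt_iff₀ hμpos]
        have := hβμ a b
        nlinarith [Real.pi_gt_three]
      have h4 : hs X HYh = ∑ a, ∑ b, ‖X' a b‖ ^ 2 * (1 - ψ ((θ a / μ - θ b / μ) / 2)) :=
        hs_solution_eq hU hU' (fun a => θ a / μ) hβπ' hYhU X HYh hHYh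
      have h5 : ∑ i, c i * hs X (H i) = μ * ∑ i, ch i * hs X (H i) := by
        rw [Finset.mul_sum]
        refine Finset.sum_congr rfl fun i _ => ?_
        rw [hch]; simp only; field_simp
      calc ∑ i, c i * hs X (H i) = μ * ∑ i, ch i * hs X (H i) := h5
        _ ≤ μ * hs X HYh := mul_le_mul_of_nonneg_left hj hμpos.le
        _ = ∑ a, ∑ b, ‖X' a b‖ ^ 2 * (μ * (1 - ψ ((θ a - θ b) / 2 / μ))) := by
            rw [h4, Finset.mul_sum]
            refine Finset.sum_congr rfl fun a _ => ?_
            rw [Finset.mul_sum]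
            refine Finset.sum_congr rfl fun b _ => ?_
            rw [show (θ a / μ - θ b / μ) / 2 = (θ a - θ b) / 2 / μ by ring]
            ring
    · have hc : ∀ i, c i = 0 := fun i =>
        (Finset.sum_eq_zero_iff_of_nonneg (fun i _ => hc0 i)).1 hμz.symm i (Finset.mem_univ i)
      have h0 : ∑ i, c i * hs X (H i) = 0 := Finset.sum_eq_zero fun i _ => by rw [hc i, zero_mul]
      rw [h0, ← hμz]
      simp
  -- (4), (5): the entrywise perspective inequality, summed
  have h6 : ∀ a b, (1 - μ) * (‖X' a b‖ ^ 2 * (Real.sinc ((θ a - θ b) / 2))⁻¹)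
      + ‖X' a b‖ ^ 2 * (μ * (1 - ψ ((θ a - θ b) / 2 / μ))) ≤ ‖X' a b‖ ^ 2 * (1 - ψ ((θ a - θ b) / 2)) := by
    intro a b
    have hp := mul_le_mul_of_nonneg_left (persp_scalar (hβμ a b) hc1) (sq_nonneg ‖X' a b‖)
    nlinarith [hp]
  have h7 : (1 - μ) * (∑ a, ∑ b, ‖X' a b‖ ^ 2 * (Real.sinc ((θ a - θ b) / 2))⁻¹)
      + ∑ a, ∑ b, ‖X' a b‖ ^ 2 * (μ * (1 - ψ ((θ a - θ b) / 2 / μ)))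
      ≤ ∑ a, ∑ b, ‖X' a b‖ ^ 2 * (1 - ψ ((θ a - θ b) / 2)) := by
    rw [Finset.mul_sum, ← Finset.sum_add_distrib]
    refine Finset.sum_le_sum fun a _ => ?_
    rw [Finset.mul_sum, ← Finset.sum_add_distrib]
    exact Finset.sum_le_sum fun b _ => h6 a b
  rw [h1, h2]
  linarith [h3, h7]

end Sharp

/-! ## §4 The fibre map `K_W = exp(Σᵢ cᵢ log(hᵢ W*))·W`: sharp coercivity of `D K_W` on the tangent space, and its norm form -/

section Fibre

variable [Nonempty m] {ι : Type*} [Fintype ι]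

omit [Nonempty m] in
/-- **The guard data.**  On the guard `‖hᵢW* − 1‖ < 1∕2` (unitaries): each `Zᵢ = log(hᵢW*)` is skew-Hermitian with `‖Zᵢ‖ ≤ 1`, and
`Y = ΣcᵢZᵢ` (`cᵢ ≥ 0`, `Σcᵢ ≤ 1`) is skew-Hermitian with `‖Y‖ ≤ 1`. [folklore] -/
theorem guard_skew_norm {h : ι → Matrix m m ℂ} (hh : ∀ i, h i ∈ unitaryGroup m ℂ) {W : Matrix m m ℂ}
    (hWu : W ∈ unitaryGroup m ℂ) (hg : ∀ i, ‖h i * star W - 1‖ < 1 / 2) {c : ι → ℝ} (hc0 : ∀ i, 0 ≤ c i)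
    (hc1 : ∑ i, c i ≤ 1) :
    (∀ i, (mlog (h i * star W))ᴴ = -mlog (h i * star W)) ∧ (∀ i, ‖mlog (h i * star W)‖ ≤ 1) ∧
      (∑ i, (c i : ℂ) • mlog (h i * star W))ᴴ = -∑ i, (c i : ℂ) • mlog (h i * star W) ∧
      ‖∑ i, (c i : ℂ) • mlog (h i * star W)‖ ≤ 1 := by
  have hPu : ∀ i, h i * star W ∈ unitaryGroup m ℂ := fun i => mul_mem (hh i) (Unitary.star_mem hWu)
  have hZskew : ∀ i, (mlog (h i * star W))ᴴ = -mlog (h i * star W) := fun i => by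
    rw [← Matrix.star_eq_conjTranspose]; exact star_mlog_of_unitary (hPu i) (hg i)
  have hZ1 : ∀ i, ‖mlog (h i * star W)‖ ≤ 1 := fun i => by
    have h1 := norm_mlog_lt_log_two (hg i); have h2 := Real.log_two_lt_d9; linarith
  refine ⟨hZskew, hZ1, conjTranspose_sum_smul c hZskew, ?_⟩
  calc ‖∑ i, (c i : ℂ) • mlog (h i * star W)‖ ≤ ∑ i, ‖(c i : ℂ) • mlog (h i * star W)‖ := norm_sum_le _ _
    _ ≤ ∑ i, c i := Finset.sum_le_sum fun i _ => by
        rw [norm_smul, Complex.norm_real, Real.norm_of_nonneg (hc0 i)]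
        nlinarith [hZ1 i, hc0 i, norm_nonneg (mlog (h i * star W))]
    _ ≤ 1 := hc1

omit [Nonempty m] in
/-- A skew-Hermitian `Y` with `‖Y‖ ≤ 1` has an eigenframe with all half-angles `|β_{ab}| < π`. [folklore] -/
theorem exists_frame_lt_pi {Y : Matrix m m ℂ} (hY : Yᴴ = -Y) (hY1 : ‖Y‖ ≤ 1) :
    ∃ (U : Matrix m m ℂ) (θ : m → ℝ), star U * U = 1 ∧ U * star U = 1 ∧
      Y = U * diagonal (fun a => -I * (θ a : ℂ)) * star U ∧ ∀ a b, |(θ a - θ b) / 2| < Real.pi := by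
  obtain ⟨U, θ, hU, hU', hYU, hθ⟩ := frame hY
  refine ⟨U, θ, hU, hU', hYU, fun a b => ?_⟩
  rw [abs_div, abs_two]
  have := abs_sub (θ a) (θ b)
  linarith [(hθ a).trans hY1, (hθ b).trans hY1, Real.pi_gt_three]

/-- ★★ **SHARP COERCIVITY OF THE TANGENT MAP OF THE PRINTED exp-mean-log FIBRE MAP.**  For unitary `W`, unitaries `hᵢ` in the
guard `‖hᵢW* − 1‖ < 1∕2`, weights `cᵢ ≥ 0` with `Σcᵢ ≤ 1`, a skew-Hermitian `X`, `X̃ = W X W*`, `Y = Σᵢ cᵢ log(hᵢW*)`, and ANY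
`G'`, `G♭` with `dexp(Y) G' = D K_W(W X)·W*`, `dexp(Y) G♭ = e^{Y∕2} X̃ e^{Y∕2}`:
  `(1 − Σcᵢ)·hs(X̃, G♭) ≤ hs(X̃, G')`.
Since `D K_W(WX) = e^{Y}·[X̃ − (dexp Y)⁻¹-twisted average]·W`, `G'` is the symmetrised tangent image `Q X̃` and `G♭ = χ(B_Y) X̃`: the
operator statement is `Q ⪰ (1 − Σcᵢ)·χ(B_Y)`, i.e. `χ^{−1∕2} Q χ^{−1∕2} ⪰ (1 − Σcᵢ)` for the symmetric factor of the tangent map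
`(unitary)·χ(B_Y)⁻¹·Q` — at the determinant ∕ eigenvalue level the conjectured sharp constant `1 − Σcᵢ` (`GuardJacobian.emlD_flat`:
equality at the flat background). [folklore] -/
theorem emlD_sharp_coercive_hs {h : ι → Matrix m m ℂ} (hh : ∀ i, h i ∈ unitaryGroup m ℂ) {W : Matrix m m ℂ}
    (hWu : W ∈ unitaryGroup m ℂ) (hg : ∀ i, ‖h i * star W - 1‖ < 1 / 2) {c : ι → ℝ} (hc0 : ∀ i, 0 ≤ c i)
    (hc1 : ∑ i, c i ≤ 1) (X : Matrix m m ℂ) (hX : Xᴴ = -X) (G' Gf : Matrix m m ℂ)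
    (hG' : dexp (∑ i, (c i : ℂ) • mlog (h i * star W)) G' = emlD h c W (W * X) * star W)
    (hGf : dexp (∑ i, (c i : ℂ) • mlog (h i * star W)) Gf
      = exp ((2⁻¹ : ℂ) • ∑ i, (c i : ℂ) • mlog (h i * star W)) * (W * X * star W)
        * exp ((2⁻¹ : ℂ) • ∑ i, (c i : ℂ) • mlog (h i * star W))) :
    (1 - ∑ i, c i) * hs (W * X * star W) Gf ≤ hs (W * X * star W) G' := by
  have hW1 : star W * W = 1 := Matrix.mem_unitaryGroup_iff'.mp hWu
  have hW2 : W * star W = 1 := Matrix.mem_unitaryGroup_iff.mp hWu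
  have hP1 : ∀ i, ‖h i * star W - 1‖ < 1 := fun i => lt_trans (hg i) (by norm_num)
  obtain ⟨hZskew, hZ1, -, -⟩ := guard_skew_norm hh hWu hg hc0 hc1
  have hX' : star X = -X := by rw [Matrix.star_eq_conjTranspose, hX]
  set Y : Matrix m m ℂ := ∑ i, (c i : ℂ) • mlog (h i * star W)
  set Xt : Matrix m m ℂ := W * X * star W with hXt
  set E : Matrix m m ℂ := emlD h c W (W * X)
  set H : ι → Matrix m m ℂ := fun i => fderiv ℂ mlog (h i * star W) (h i * star W * Xt)
  have hHi : ∀ i, dexp (mlog (h i * star W)) (H i) = exp (mlog (h i * star W)) * Xt := fun i => by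
    show dexp (mlog (h i * star W)) (fderiv ℂ mlog (h i * star W) (h i * star W * Xt)) = _
    rw [dexp_mlog_fderiv (hP1 i), MatrixLog.exp_mlog (hP1 i)]
  have hPX : ∀ i, h i * star (W * X) = -(h i * star W * Xt) := by
    intro i
    rw [star_mul, hX', neg_mul, mul_neg, hXt, show h i * star W * (W * X * star W)
      = h i * (star W * W) * (X * star W) by noncomm_ring, hW1, mul_one]
  have hE : E * star W = exp Y * Xt - dexp Y (∑ i, (c i : ℂ) • H i) := by
    have h0 : E = exp Y * (W * X) + dexp Y (∑ i, (c i : ℂ) • fderiv ℂ mlog (h i * star W) (h i * star (W * X))) * W :=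
      emlD_apply h c W (W * X)
    have h1 : (∑ i, (c i : ℂ) • fderiv ℂ mlog (h i * star W) (h i * star (W * X))) = -∑ i, (c i : ℂ) • H i := by
      rw [← Finset.sum_neg_distrib]
      refine Finset.sum_congr rfl fun i _ => ?_
      rw [hPX, map_neg, smul_neg]
    have h0' : E = exp Y * (W * X) - dexp Y (∑ i, (c i : ℂ) • H i) * W := by
      rw [h0, h1, map_neg, neg_mul, ← sub_eq_add_neg]
    rw [h0', hXt, sub_mul, mul_assoc, mul_assoc (dexp Y _) W (star W), hW2, mul_one]
  have hY : dexp Y (G' + ∑ i, (c i : ℂ) • H i) = exp Y * Xt := by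
    rw [map_add, hG', hE]; abel
  have hco := sharp_coercive hZskew hZ1 c hc0 hc1 Xt H _ Gf hHi hY hGf
  have e1 : hs Xt (G' + ∑ i, (c i : ℂ) • H i) = hs Xt G' + ∑ i, c i * hs Xt (H i) := by
    rw [hs_add_right, hs_sum_right]
    congr 1
    exact Finset.sum_congr rfl fun i _ => hs_smul_right _ _ _
  rw [e1] at hco
  linarith

/-- **The flat solution exists and dominates**: on the guard, `Y = Σcᵢ log(hᵢW*)` is skew-Hermitian with `‖Y‖ ≤ 1 < π`, so
`dexp Y` is onto (`GuardJacobian.dexp_lower_bound_and_surjective`) and every `G♭` with `dexp(Y) G♭ = e^{Y∕2} X̃ e^{Y∕2}` has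
`hs(X̃, X̃) ≤ hs(X̃, G♭)` (`χ ⪰ 1`): the sharp coercivity contains `GuardJacobian.coercive`'s `(1 − Σcᵢ)·hs(X̃, X̃)`. [folklore] -/
theorem flat_solution_exists_and_dominates {h : ι → Matrix m m ℂ} (hh : ∀ i, h i ∈ unitaryGroup m ℂ) {W : Matrix m m ℂ}
    (hWu : W ∈ unitaryGroup m ℂ) (hg : ∀ i, ‖h i * star W - 1‖ < 1 / 2) {c : ι → ℝ} (hc0 : ∀ i, 0 ≤ c i)
    (hc1 : ∑ i, c i ≤ 1) (Xt : Matrix m m ℂ) :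
    (∃ Gf : Matrix m m ℂ, dexp (∑ i, (c i : ℂ) • mlog (h i * star W)) Gf
      = exp ((2⁻¹ : ℂ) • ∑ i, (c i : ℂ) • mlog (h i * star W)) * Xt * exp ((2⁻¹ : ℂ) • ∑ i, (c i : ℂ) • mlog (h i * star W))) ∧
    ∀ Gf : Matrix m m ℂ, dexp (∑ i, (c i : ℂ) • mlog (h i * star W)) Gf
      = exp ((2⁻¹ : ℂ) • ∑ i, (c i : ℂ) • mlog (h i * star W)) * Xt * exp ((2⁻¹ : ℂ) • ∑ i, (c i : ℂ) • mlog (h i * star W)) →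
      hs Xt Xt ≤ hs Xt Gf := by
  obtain ⟨-, -, hYskew, hYn⟩ := guard_skew_norm hh hWu hg hc0 hc1
  have hπ3 : (3 : ℝ) < Real.pi := Real.pi_gt_three
  refine ⟨(dexp_lower_bound_and_surjective hYskew one_pos (by linarith) hYn).2 _, fun Gf hGf => ?_⟩
  obtain ⟨U, θ, hU, hU', hYU, hβπ⟩ := exists_frame_lt_pi hYskew hYn
  exact hs_self_le_hs_flat_solution hU hU' θ hβπ hYU Xt Gf hGf

/-- ★ **THE NORM FORM.**  Same setting; for every flat solution `G♭`:
  `((1 − Σcᵢ)·hs(X̃, G♭))² ≤ hs(G♭, G♭) · hs(D K_W(W X), D K_W(W X))`,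
i.e. `‖D K_W(W X)‖_HS ≥ (1 − Σcᵢ)·⟨X̃, χX̃⟩ ∕ ‖χX̃‖_HS` (`χ = χ(B_Y) ⪰ 1`, `G♭ = χX̃`).  By `⟨X̃,χX̃⟩ ≥ ‖X̃‖²` and `‖χX̃‖ ≤ (ρ∕sin ρ)‖X̃‖`
this returns `GuardJacobian.emlD_tangent_lower_bound` (`(1 − Σcᵢ)·sin ρ∕ρ`); by Kantorovich it gives `(1 − Σcᵢ)·2√κ∕(1+κ)`,
`κ = ρ∕sin ρ`; the operator-norm form «`σ_min ≥ 1 − Σcᵢ`» itself (`Q² ⪰ (1−Σcᵢ)²χ²`) is NOT asserted here. [folklore] -/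
theorem emlD_sharp_lower_bound_hs {h : ι → Matrix m m ℂ} (hh : ∀ i, h i ∈ unitaryGroup m ℂ) {W : Matrix m m ℂ}
    (hWu : W ∈ unitaryGroup m ℂ) (hg : ∀ i, ‖h i * star W - 1‖ < 1 / 2) {c : ι → ℝ} (hc0 : ∀ i, 0 ≤ c i)
    (hc1 : ∑ i, c i ≤ 1) (X : Matrix m m ℂ) (hX : Xᴴ = -X) (Gf : Matrix m m ℂ)
    (hGf : dexp (∑ i, (c i : ℂ) • mlog (h i * star W)) Gf
      = exp ((2⁻¹ : ℂ) • ∑ i, (c i : ℂ) • mlog (h i * star W)) * (W * X * star W)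
        * exp ((2⁻¹ : ℂ) • ∑ i, (c i : ℂ) • mlog (h i * star W))) :
    ((1 - ∑ i, c i) * hs (W * X * star W) Gf) ^ 2
      ≤ hs Gf Gf * hs (emlD h c W (W * X)) (emlD h c W (W * X)) := by
  have hW1 : star W * W = 1 := Matrix.mem_unitaryGroup_iff'.mp hWu
  obtain ⟨-, -, hYskew, hYn⟩ := guard_skew_norm hh hWu hg hc0 hc1
  set Y : Matrix m m ℂ := ∑ i, (c i : ℂ) • mlog (h i * star W)
  set Xt : Matrix m m ℂ := W * X * star W with hXt
  set E : Matrix m m ℂ := emlD h c W (W * X)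
  have hπ3 : (3 : ℝ) < Real.pi := Real.pi_gt_three
  obtain ⟨G', hG'⟩ := (dexp_lower_bound_and_surjective hYskew one_pos (by linarith) hYn).2 (E * star W)
  obtain ⟨U, θ, hU, hU', hYU, hβπ⟩ := exists_frame_lt_pi hYskew hYn
  have h1 := emlD_sharp_coercive_hs hh hWu hg hc0 hc1 X hX G' Gf hG' hGf
  have h2 := hs_sq_le_frame hU hU' θ hβπ hYU Xt G' Gf hGf
  rw [hG', hs_mul_star_unitary hW1] at h2
  have h0 : 0 ≤ (1 - ∑ i, c i) * hs Xt Gf :=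
    mul_nonneg (sub_nonneg.2 hc1) ((hs_self_nonneg Xt).trans (hs_self_le_hs_flat_solution hU hU' θ hβπ hYU Xt Gf hGf))
  calc ((1 - ∑ i, c i) * hs Xt Gf) ^ 2 ≤ (hs Xt G') ^ 2 := pow_le_pow_left₀ h0 h1 2
    _ = hs Xt G' * hs Xt G' := sq _
    _ ≤ hs Gf Gf * hs E E := h2

/-- **At the typed guard of the printed average on `SU(N)`** (`ExpMeanLog.expMeanLogSU`, radius `deltaSU = min(1∕3, π∕N) < 1∕2`):
the sharp coercivity holds verbatim for `hᵢ, W ∈ SU(N)`, every `N`. [folklore] -/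
theorem emlD_sharp_coercive_hs_specialUnitary {n : Type} [DecidableEq n] [Fintype n] [Nonempty n]
    (h : ι → Matrix.specialUnitaryGroup n ℂ) (W : Matrix.specialUnitaryGroup n ℂ)
    (hg : ∀ i, ‖(h i : Matrix n n ℂ) * star (W : Matrix n n ℂ) - 1‖ < ExpMeanLog.deltaSU n)
    {c : ι → ℝ} (hc0 : ∀ i, 0 ≤ c i) (hc1 : ∑ i, c i ≤ 1) (X : Matrix n n ℂ) (hX : Xᴴ = -X) (G' Gf : Matrix n n ℂ)
    (hG' : dexp (∑ i, (c i : ℂ) • mlog ((h i : Matrix n n ℂ) * star (W : Matrix n n ℂ))) G'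
      = emlD (fun i => (h i : Matrix n n ℂ)) c W (W * X) * star (W : Matrix n n ℂ))
    (hGf : dexp (∑ i, (c i : ℂ) • mlog ((h i : Matrix n n ℂ) * star (W : Matrix n n ℂ))) Gf
      = exp ((2⁻¹ : ℂ) • ∑ i, (c i : ℂ) • mlog ((h i : Matrix n n ℂ) * star (W : Matrix n n ℂ)))
        * ((W : Matrix n n ℂ) * X * star (W : Matrix n n ℂ))
        * exp ((2⁻¹ : ℂ) • ∑ i, (c i : ℂ) • mlog ((h i : Matrix n n ℂ) * star (W : Matrix n n ℂ)))) :
    (1 - ∑ i, c i) * hs ((W : Matrix n n ℂ) * X * star (W : Matrix n n ℂ)) Gf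
      ≤ hs ((W : Matrix n n ℂ) * X * star (W : Matrix n n ℂ)) G' := by
  have hh : ∀ i, (h i : Matrix n n ℂ) ∈ unitaryGroup n ℂ := fun i => (Matrix.mem_specialUnitaryGroup_iff.mp (h i).2).1
  have hWu : (W : Matrix n n ℂ) ∈ unitaryGroup n ℂ := (Matrix.mem_specialUnitaryGroup_iff.mp W.2).1
  have hg' : ∀ i, ‖(h i : Matrix n n ℂ) * star (W : Matrix n n ℂ) - 1‖ < 1 / 2 := fun i => by
    have := ExpMeanLog.lt_third_of_lt_deltaSU (hg i); linarith
  exact emlD_sharp_coercive_hs hh hWu hg' hc0 hc1 X hX G' Gf hG' hGf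

end Fibre

end Summit.QuantumFields.YangMills.BalabanUVNodes.N08HaarCompatibilityGuardJacobianSharp

end
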